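import Summits.QuantumFields.BalabanUV.T4Continuum.Spine.NE7c.LiveFactorStepFactors

/-!
# `T4Continuum.Spine.NE7c.LiveFactorRoundedRenewal` — spine estimate NE7c (node U5b), road (δ) THRESHOLD RANDOMISATION:
# each of print's FIVE preparatory large-field factors ([B16] pp. 381–383), read at a LIVE amplitude `μ ≥ λ₀`, rounds
# to print's ROUNDED renewal letter `exp(−R(g_j)^{−(d+5)}p₁(g_j)²)` at the UNCHANGED amplitude-free profile below a
# `λ₀`-dependent largeness — so the live run inhabits `StepDisplaysAt` with ONE moved letter `γ₀ ↦ λ₀²γ₀`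
# (cell `pub-balaban-gaps`, track G2, seat ne8 gen 6, file 8; record `HOME/ne/NE7c.md` §13)

HONEST FRAMING.  Finite four-torus programme, rung (B)+1 only — NOT infinite volume, NOT a mass gap, NOT the Clay
problem, NOT summit progress, NOT a proof of NE7c (`T4IndicatorShell.ShellWeightBound`, INSTANCE 0∕1, which waits on
node O) and NOT a proof of NE7b.  Nothing of [Bałaban 1983–89] is asserted beyond print: the five factors enter as the
tree's PROVED transcriptions of pp. 381–383 (`Lit.B16Sect1Statements.prep381_chi_n ∕ prep381_chi' ∕ prep381_chiΛ ∕
prep382_case1_factor`, `Lit.B16Sect1Kernels.lfFactor178_of_large`) through the companion `LiveFactorLargeField`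
(p340750), `StepDisplaysAt` is a HYPOTHESIS SHAPE (`Lit.B16StepFactorsPrinted`, p344269), and what is PROVED is
monotonicity of `exp` plus real arithmetic.  The five largeness clauses below are DISPLAYED, not joined under one
threshold here (files 1 ∕ 5 do that for their clauses; these are of the same «ℓ ≥ ℓ⋆(λ₀)» kind under print's profile
dictionary — census note at the end of this header).  This file does NOT decide which of the five factors a given renewed
component carries (node O's data) and does NOT verify census completeness (NOT PRINTED).  Spine PROVED 0∕9 — unchanged.

WHY THIS LEAF (located 2026-08-23, after gaps-ne6 g4's π-gapsne6-g4-2, OWNER t4-ne7b-p1 RULING45, refuter F305).  Print's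
per-renewal bound OF RECORD is the ROUNDED one, p. 383: «exp(−R_j^{−d−5}p₁²(g_j)). This is the largest factor among all the
small factors … in the preparatory steps» — true of the rounded members of all five preparatory factors (`1 − χ_j^{(n)}`,
`1 − χ′_m`, `1 − χ_{j,Λ}` of p. 381; `1 − χ′` CASE 1 of p. 382; `1 − χ′` CASE 2 = (1.77)–(1.78) of p. 383), NOT of the
case-2 sharp member; the NE7b lineage's END is being re-pinned to that rounded letter (`sRrnd`), which does not see `γ₀`.
For road (δ)'s lowered-threshold run the END-compatible live letters on the J4 side are therefore `{c with γ₀ := λ₀²γ₀}`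
ALONE (`c.P1 = ℓ^{p₁}` amplitude-free untouched; companion `LiveFactorEndLetters` §3), and the one thing to check is that
EACH live preparatory factor — print's factor with its threshold amplitude multiplied by `μ ∈ [λ₀, 1]` — still sits below
the UNCHANGED rounded letter.  File 6's two-letter convention `{γ₀ ↦ λ₀²γ₀, P1 ↦ λ₀P1}` got this by pure monotonicity at
a lowered letter; here the letter stays print's and the `λ₀²` is absorbed by print's own rounding slack, factor by factor:
* §1 `roundedP_of_chi_n_live` ∕ `roundedP_of_chiΛ_live`: the two `p₀`-type factors end (file 1) at `exp(−λ₀²A₁²p₀(g_j)²)`;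
  below the rounded letter as soon as `p₁(g_j) ≤ λ₀A₁p₀(g_j)` and `R(g_j) ≥ 1` («g_j small»: `p₁ < p₀`).
  `roundedP_of_chi'_live`: the `1 − χ′_m` factor ends at `exp(−λ₀²γ₀A₁²p₁(g_j)²)`; below the rounded letter as soon as
  `1 ≤ λ₀²γ₀A₁²R(g_j)^{d+5}`.  `roundedP_of_case1_live`: p. 382's Wilson factor at the live threshold,
  `exp(−(μA₁)²48⁻²R_j⁻⁸p₁(g_j)²)`; below the rounded letter as soon as `48²R_j⁸ ≤ λ₀²A₁²R_j^{d+5}` — at `d = 4` ONE power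
  of `R_j` of room, `R_j ≥ 48²∕(λ₀²A₁²)` (print's own rounding used `A₁ ≥ 48`, which does NOT survive `A₁ ↦ λ₀A₁`: the room
  is the dimension's, an Edison-grade located item — at `d = 3` the clause would pin `λ₀ ≥ 48∕A₁`).
  `roundedP_of_case2_live`: (1.78)'s sharp member at the live threshold, below the rounded letter under print's largeness
  read at the live letter `12(d+3)(100M(L+1)N^{β₀})^{d+2} < λ₀²γ₀A₁²R_j³` (`lfFactor178_of_large` at `γ₀ := λ₀²γ₀`).
* PRINT's OWN five comparisons at `μ = 1` (the «largest factor» sentence of p. 383 as a leaf) are gaps-ne6 g5's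
  `Lit.B16PrepFactorsLargest383` (p348828 ✓, 2026-08-23T02:32Z); this file is their live-threshold `μ ≥ λ₀` version with
  the `λ₀`-clauses displayed, on disjoint names, built on file 1's live chains (it does not import that leaf).
* §2 `stepDisplaysAt_live_oneLetter`: the live step sentences — (Y), (V), (I) unchanged, (F) at the scaled amplitudes
  `(μA₀, μA₁)` (as in file 6), and (P) in print's ROUNDED form at the UNCHANGED profile (discharged per renewed component by
  whichever §1 lemma applies — node O's case data) — inhabit `StepDisplaysAt D j X {c with γ₀ := λ₀²γ₀}`, the input of
  `LiveFactorEndLetters.hwPinned_live_oneLetter_of_stepDisplaysAt` (⟹ `HwPinned T 𝒮 (λ₀²·sBsharp D c) (sRsharp D c) …`).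

CENSUS NOTE (kernel-invisible; the §1 lemmas are stated over abstract reals `p₀g`, `p₁g`, `Rj`).  With the amplitude-free
profile values of `Lit.B16Sect1Statements.prep381_chi_n` (`ε = g·A₀·p₀(g)`, `δ′ = g·A₁·p₁(g)`, `p₀(g) = ℓ^{p₀}`,
`p₁(g) = ℓ^{p₁}`, `ℓ = log g⁻² ≥ 1`) and the (2.5) bracket `ℓ^{r₀} ≤ R(g) ≤ Lℓ^{r₀}`, the four new clauses read
`ℓ^{p₀−p₁} ≥ 1∕(λ₀A₁)` (`p₁ < p₀`), `ℓ^{(d+5)r₀} ≥ 1∕(λ₀²γ₀A₁²)`, `ℓ^{(d−3)r₀} ≥ 48²∕(λ₀²A₁²)` (`d ≥ 4`), plus file 1's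
clause (ii) for case 2 — all of the «ℓ ≥ ℓ⋆(λ₀)» kind joined in file 5's `roadDelta_clauses_of_g_small` (not re-joined here).  HONEST DEPENDENCY
(cell): continuum YM on T⁴ ⇐ BetaPertH ∧ nine spine estimates (0∕9 proved); BetaPertH ⇐ (D1) ∧ (D4) ∧ CAP+tail.  This
file changes none of it.
-/

namespace Summit.QuantumFields.BalabanUV.T4Continuum.Spine.NE7c.LiveFactorRoundedRenewal

open Literature.MathematicalPhysics.QuantumFieldTheory.Balaban1983to89
open B16LargeFieldFactors380 B16StepFactorsPrinted B16Sect1Statements B16Sect1Kernels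
open Summit.QuantumFields.BalabanUV.T4Continuum.Spine.NE7c.LiveFactorLargeField
open Summit.QuantumFields.BalabanUV.T4Continuum.Spine.NE7c.LiveFactorStepFactors

noncomputable section

/-! ## §1. The five preparatory factors at a live amplitude, each below print's ROUNDED letter at the unchanged profile -/

section Factors

variable {lam₀ μ Rj A₁ p₀g p₁g : ℝ} {d : ℕ}

/-- the common last step: a live exponent `λ₀²·E` dominating the rounded one `R^{−(d+5)}p₁²` [folklore] -/
theorem exp_roundedP_of_le {E : ℝ} (h : (Rj ^ (d + 5))⁻¹ * p₁g ^ 2 ≤ lam₀ ^ 2 * E) :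
    Real.exp (-(lam₀ ^ 2 * E)) ≤ Real.exp (-((Rj ^ (d + 5))⁻¹ * p₁g ^ 2)) :=
  Real.exp_le_exp.mpr (neg_le_neg h)

/-- the `p₀`-type clause: `R ≥ 1` and `p₁(g) ≤ λ₀A₁p₀(g)` put the rounded exponent below `λ₀²A₁²p₀(g)²` [folklore] -/
theorem roundedExp_le_of_p0clause (hR : 1 ≤ Rj) (hp1 : 0 ≤ p₁g) (hNP : p₁g ≤ lam₀ * A₁ * p₀g) :
    (Rj ^ (d + 5))⁻¹ * p₁g ^ 2 ≤ lam₀ ^ 2 * (A₁ ^ 2 * p₀g ^ 2) := by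
  have hR5 : 1 ≤ Rj ^ (d + 5) := one_le_pow₀ hR
  have hinv : (Rj ^ (d + 5))⁻¹ ≤ 1 := inv_le_one_of_one_le₀ hR5
  have hsq : p₁g ^ 2 ≤ (lam₀ * A₁ * p₀g) ^ 2 := pow_le_pow_left₀ hp1 hNP 2
  calc (Rj ^ (d + 5))⁻¹ * p₁g ^ 2 ≤ 1 * p₁g ^ 2 := mul_le_mul_of_nonneg_right hinv (sq_nonneg _)
    _ ≤ (lam₀ * A₁ * p₀g) ^ 2 := by rw [one_mul]; exact hsq
    _ = lam₀ ^ 2 * (A₁ ^ 2 * p₀g ^ 2) := by ring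

/-- **p. 381, `1 − χ_j^{(n)}` AT A LIVE REGULARITY THRESHOLD `με_m`, BELOW THE ROUNDED LETTER**: file 1's
`prep381_chi_n_live` (print's chain at `(μA₀, μA₁)`, ending at `exp(−λ₀²A₁²p₀(g_j)²)`) followed by the `p₀`-clause
`p₁(g_j) ≤ λ₀A₁p₀(g_j)`, `R_j ≥ 1`.  Inputs otherwise exactly print's. [folklore] -/
theorem roundedP_of_chi_n_live {gm B₃ εm A₀ p₀gm β₀ : ℝ} (hgm : gm ≠ 0) (hB₃ : B₃ ≠ 0)
    (hε : εm = gm * A₀ * p₀gm) (hβ : 0 ≤ β₀) (hp0 : 0 ≤ p₀g) (hp : (1 + β₀)⁻¹ * p₀g ≤ p₀gm)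
    (hR2 : 8 * B₃ ^ 2 * (1 + β₀) ^ 2 * A₁ ^ 2 ≤ A₀ ^ 2) (hlam : 0 ≤ lam₀) (hμ : lam₀ ≤ μ)
    (hR : 1 ≤ Rj) (hp1 : 0 ≤ p₁g) (hNP : p₁g ≤ lam₀ * A₁ * p₀g) :
    Real.exp (-(1 / 4 * (1 / gm ^ 2) * (B₃ ^ 2)⁻¹ * (1 / 2) * (μ * εm) ^ 2)) ≤
      Real.exp (-((Rj ^ (d + 5))⁻¹ * p₁g ^ 2)) :=
  (prep381_chi_n_live hgm hB₃ hε hβ hp0 hp hR2 hlam hμ).trans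
    (exp_roundedP_of_le (roundedExp_le_of_p0clause hR hp1 hNP))

/-- **p. 381, `1 − χ_{j,Λ}` AT THE LIVE THRESHOLD `με_j`, BELOW THE ROUNDED LETTER**: file 1's `prep381_chiΛ_live`
followed by the same `p₀`-clause. [folklore] -/
theorem roundedP_of_chiΛ_live {gj K εj A₀ : ℝ} (hgj : gj ≠ 0) (hK : 0 < K) (hε : εj = gj * A₀ * p₀g)
    (hR3 : 4 * K * A₁ ^ 2 ≤ A₀ ^ 2) (hlam : 0 ≤ lam₀) (hμ : lam₀ ≤ μ)
    (hR : 1 ≤ Rj) (hp1 : 0 ≤ p₁g) (hNP : p₁g ≤ lam₀ * A₁ * p₀g) :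
    Real.exp (-(1 / 4 * (1 / gj ^ 2) * K⁻¹ * (μ * εj) ^ 2)) ≤ Real.exp (-((Rj ^ (d + 5))⁻¹ * p₁g ^ 2)) :=
  (prep381_chiΛ_live hgj hK hε hR3 hlam hμ).trans (exp_roundedP_of_le (roundedExp_le_of_p0clause hR hp1 hNP))

/-- **p. 381, `1 − χ′_m` AT A LIVE FLUCTUATION THRESHOLD `μδ′_m`, BELOW THE ROUNDED LETTER**: file 1's
`prep381_chi'_live` (ending at `exp(−λ₀²γ₀A₁²p₁(g_j)²)`) followed by the clause `1 ≤ λ₀²γ₀A₁²R_j^{d+5}`. [folklore] -/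
theorem roundedP_of_chi'_live {γ₀ gm δ'm p₁gm β₀ : ℝ} (hgm : gm ≠ 0) (hγ : 0 ≤ γ₀)
    (hδ : δ'm = gm * A₁ * p₁gm) (hβ0 : 0 ≤ β₀) (hβ1 : β₀ ≤ 1) (hp0 : 0 ≤ p₁g)
    (hp : (1 + β₀)⁻¹ * p₁g ≤ p₁gm) (hlam : 0 ≤ lam₀) (hμ : lam₀ ≤ μ) (hR : 0 < Rj)
    (hlargeP : 1 ≤ lam₀ ^ 2 * γ₀ * A₁ ^ 2 * Rj ^ (d + 5)) :
    Real.exp (-(γ₀ * (1 / gm ^ 2) * (2 * (μ * δ'm)) ^ 2)) ≤ Real.exp (-((Rj ^ (d + 5))⁻¹ * p₁g ^ 2)) := by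
  refine (prep381_chi'_live hgm hγ hδ hβ0 hβ1 hp0 hp hlam hμ).trans (exp_roundedP_of_le ?_)
  have hR5 : 0 < Rj ^ (d + 5) := pow_pos hR _
  have hinv : (Rj ^ (d + 5))⁻¹ ≤ lam₀ ^ 2 * γ₀ * A₁ ^ 2 := by
    rw [inv_le_iff_one_le_mul₀ hR5]
    linarith [hlargeP]
  calc (Rj ^ (d + 5))⁻¹ * p₁g ^ 2 ≤ lam₀ ^ 2 * γ₀ * A₁ ^ 2 * p₁g ^ 2 :=
      mul_le_mul_of_nonneg_right hinv (sq_nonneg _)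
    _ = lam₀ ^ 2 * (γ₀ * A₁ ^ 2 * p₁g ^ 2) := by ring

/-- **p. 382 CASE 1, THE WILSON FACTOR AT THE LIVE THRESHOLD `μδ′_j`, BELOW THE ROUNDED LETTER**: print's
`exp(−¼g_j⁻²(24R_j⁴)⁻²(μδ′_j)²) = exp(−(μA₁)²48⁻²R_j⁻⁸p₁(g_j)²)` (`prep382_case1_factor` at the amplitude `μA₁`), then
the clause `48²R_j⁸ ≤ λ₀²A₁²R_j^{d+5}` — at `d = 4` one power of `R_j` of room absorbs `λ₀²` (print's `A₁ ≥ 48` does not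
survive `A₁ ↦ λ₀A₁`; the dimension's room does). [folklore] -/
theorem roundedP_of_case1_live {gj δ'j : ℝ} (hgj : gj ≠ 0) (hR : 0 < Rj) (hδ : δ'j = gj * A₁ * p₁g)
    (hlam : 0 ≤ lam₀) (hμ : lam₀ ≤ μ) (hlarge1 : 48 ^ 2 * Rj ^ 8 ≤ lam₀ ^ 2 * A₁ ^ 2 * Rj ^ (d + 5)) :
    Real.exp (-(1 / 4 * (1 / gj ^ 2) * ((24 * Rj ^ 4) ^ 2)⁻¹ * (μ * δ'j) ^ 2)) ≤
      Real.exp (-((Rj ^ (d + 5))⁻¹ * p₁g ^ 2)) := by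
  have hδ' : μ * δ'j = gj * (μ * A₁) * p₁g := by rw [hδ]; ring
  -- print's equality at the live amplitude (its inequality needs `48 ≤ μA₁`, which we do NOT use)
  have e : Real.exp (-(1 / 4 * (1 / gj ^ 2) * ((24 * Rj ^ 4) ^ 2)⁻¹ * (μ * δ'j) ^ 2)) =
      Real.exp (-((μ * A₁) ^ 2 * (48 ^ 2 : ℝ)⁻¹ * (Rj ^ 8)⁻¹ * p₁g ^ 2)) := by
    congr 2
    rw [hδ']
    have hR4 : Rj ^ 4 ≠ 0 := pow_ne_zero 4 hR.ne'
    field_simp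
    ring
  rw [e]
  refine Real.exp_le_exp.mpr (neg_le_neg ?_)
  have hR8 : 0 < Rj ^ 8 := pow_pos hR _
  have hR5 : 0 < Rj ^ (d + 5) := pow_pos hR _
  have hμ2 : lam₀ ^ 2 ≤ μ ^ 2 := pow_le_pow_left₀ hlam hμ 2
  -- compare the two coefficients of `p₁g²` after clearing `R_j⁸·R_j^{d+5}·48²`
  have key : (Rj ^ (d + 5))⁻¹ ≤ (μ * A₁) ^ 2 * (48 ^ 2 : ℝ)⁻¹ * (Rj ^ 8)⁻¹ := by
    rw [show (μ * A₁) ^ 2 * (48 ^ 2 : ℝ)⁻¹ * (Rj ^ 8)⁻¹ = μ ^ 2 * A₁ ^ 2 / (48 ^ 2 * Rj ^ 8) by ring,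
      le_div_iff₀ (by positivity), ← one_div, div_mul_eq_mul_div, one_mul, div_le_iff₀ hR5]
    calc 48 ^ 2 * Rj ^ 8 ≤ lam₀ ^ 2 * A₁ ^ 2 * Rj ^ (d + 5) := hlarge1
      _ ≤ μ ^ 2 * A₁ ^ 2 * Rj ^ (d + 5) := by
          have h0 : 0 ≤ A₁ ^ 2 * Rj ^ (d + 5) := by positivity
          nlinarith [mul_le_mul_of_nonneg_right hμ2 h0]
  exact mul_le_mul_of_nonneg_right key (sq_nonneg _)

/-- **p. 383 CASE 2, (1.77)–(1.78)'s SHARP MEMBER AT THE LIVE THRESHOLD, BELOW THE ROUNDED LETTER**: monotone in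
`μ ≥ λ₀`, then print's own rounding `lfFactor178_of_large` READ AT THE LIVE LETTER `γ₀ := λ₀²γ₀` (largeness
`12(d+3)(100M(L+1)N^{β₀})^{d+2} < λ₀²γ₀A₁²R_j³`, file 1's clause (ii)). [folklore] -/
theorem roundedP_of_case2_live {γ₀ M L Nβ : ℝ} (hR : 0 < Rj) (hp : p₁g ≠ 0) (hbase : 0 < 100 * M * (L + 1) * Nβ)
    (hγ : 0 ≤ γ₀) (hlam : 0 ≤ lam₀) (hμ : lam₀ ≤ μ)
    (hlarge2 : 12 * (d + 3) * (100 * M * (L + 1) * Nβ) ^ (d + 2) < lam₀ ^ 2 * γ₀ * A₁ ^ 2 * Rj ^ 3) :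
    Real.exp (-(1 / 2 * γ₀ * (6 * ((d : ℝ) + 3) * (100 * M * (L + 1) * Nβ * Rj) ^ (d + 2))⁻¹ * (μ * A₁) ^ 2 * p₁g ^ 2)) ≤
      Real.exp (-((Rj ^ (d + 5))⁻¹ * p₁g ^ 2)) := by
  set W := 6 * ((d : ℝ) + 3) * (100 * M * (L + 1) * Nβ * Rj) ^ (d + 2) with hW
  have hW0 : 0 < W := by positivity
  have hK0 : 0 ≤ 1 / 2 * γ₀ * W⁻¹ * A₁ ^ 2 * p₁g ^ 2 := by
    have := inv_nonneg.mpr hW0.le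
    positivity
  -- monotone in the live amplitude
  have hmono : Real.exp (-(1 / 2 * γ₀ * W⁻¹ * (μ * A₁) ^ 2 * p₁g ^ 2)) ≤
      Real.exp (-(1 / 2 * (lam₀ ^ 2 * γ₀) * W⁻¹ * A₁ ^ 2 * p₁g ^ 2)) := by
    refine Real.exp_le_exp.mpr (neg_le_neg ?_)
    have hμ2 : lam₀ ^ 2 ≤ μ ^ 2 := pow_le_pow_left₀ hlam hμ 2
    have h := mul_le_mul_of_nonneg_right hμ2 hK0
    calc 1 / 2 * (lam₀ ^ 2 * γ₀) * W⁻¹ * A₁ ^ 2 * p₁g ^ 2 = lam₀ ^ 2 * (1 / 2 * γ₀ * W⁻¹ * A₁ ^ 2 * p₁g ^ 2) := by ring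
      _ ≤ μ ^ 2 * (1 / 2 * γ₀ * W⁻¹ * A₁ ^ 2 * p₁g ^ 2) := h
      _ = 1 / 2 * γ₀ * W⁻¹ * (μ * A₁) ^ 2 * p₁g ^ 2 := by ring
  -- print's rounding at the live letter
  have hround := lfFactor178_of_large (γ₀ := lam₀ ^ 2 * γ₀) (A₁ := A₁) (d := d) hR hp hbase (by exact_mod_cast hlarge2)
  unfold lfFactor178 at hround
  have e : -(1 / 2) * (lam₀ ^ 2 * γ₀) * W⁻¹ * A₁ ^ 2 * p₁g ^ 2 = -(1 / 2 * (lam₀ ^ 2 * γ₀) * W⁻¹ * A₁ ^ 2 * p₁g ^ 2) := by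
    ring
  have e2 : -(Rj ^ (d + 5))⁻¹ * p₁g ^ 2 = -((Rj ^ (d + 5))⁻¹ * p₁g ^ 2) := by ring
  rw [hW] at e hmono
  rw [e, e2] at hround
  exact hmono.trans hround.le

end Factors

/-! ## §2. The live step sentences inhabit `StepDisplaysAt` with ONE moved letter -/

section OneLetter

variable {D : B16.RunData} {j : ℕ} {X : StepCarriers D j} {c : B16StepFactorsPrinted.Consts} {lam₀ : ℝ}

/-- **ROAD (δ)'s LIVE STEP SENTENCES INHABIT `StepDisplaysAt D j X {c with γ₀ := λ₀²γ₀}`** — the END-compatible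
one-letter convention (`c.P1` amplitude-free untouched).  Hypotheses: (Y), (V), (I) unchanged; (F) per created component
at the scaled amplitudes `(μA₀, μA₁)`, `μ = μF p i ≥ λ₀` (as in file 6); (P) per renewed component in print's ROUNDED
form AT THE UNCHANGED PROFILE, `lfPrep ≤ exp(−R(g_j)^{−(d+5)}·P1(g_j)²)` — which the live run's builder discharges, per
component, by whichever §1 lemma matches the preparatory factor that component carries (node O's case data), below the
`λ₀`-dependent largeness displayed there.  Then (F) is monotonicity (`exp_live_le`, `minConst_live`) and (P) passes
through: the conclusion is the input of `LiveFactorEndLetters.hwPinned_live_oneLetter_of_stepDisplaysAt`. [folklore] -/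
theorem stepDisplaysAt_live_oneLetter (h0 : 0 ≤ lam₀) (hγ : 0 ≤ c.γ₀)
    (μF : X.Choice → X.ι → ℝ) (hμF : ∀ p, ∀ i ∈ X.comps p, lam₀ ≤ μF p i)
    (hY : ∀ p v, X.T1 p v ≤
      X.gInt p * X.aInt p * X.vfac p * (∏ i ∈ X.comps p, X.bfac p i) * ∏ i ∈ X.primed p, X.lfPrep p i)
    (hV : ∀ p, 0 ≤ X.volZ p ∧ X.vfac p ≤ Real.exp (c.C380 * Real.log ((D.flow.g (j + 1)) ^ 2)⁻¹ * X.volZ p))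
    (hF : ∀ p, ∀ i ∈ X.comps p, 0 ≤ X.dC p i ∧ 0 ≤ X.bfac p i ∧
      X.bfac p i ≤ Real.exp (-(c.γ₀ * minConst c.B₃ (μF p i * c.A₀) (μF p i * c.A₁) *
        p0Profile c.A₀ c.p₀ (D.flow.g (j + 1)) ^ 2 * (X.dC p i + 1))))
    (hP : ∀ p, ∀ i ∈ X.primed p, 0 ≤ X.lfPrep p i ∧
      X.lfPrep p i ≤ Real.exp (-(c.R (D.flow.g j) ^ (c.d + 5))⁻¹ * c.P1 (D.flow.g j) ^ 2))
    (hI : ∀ p, 0 ≤ X.gInt p ∧ X.gInt p ≤ 1 ∧ 0 ≤ X.aInt p ∧ X.aInt p ≤ Real.exp (c.C' * X.volZΩ p)) :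
    StepDisplaysAt D j X { c with γ₀ := lam₀ ^ 2 * c.γ₀ } := by
  refine ⟨hY, hV, fun p i hi => ?_, hP, hI⟩
  obtain ⟨hd, hb, hle⟩ := hF p i hi
  refine ⟨hd, hb, hle.trans ?_⟩
  have hE : 0 ≤ c.γ₀ * minConst c.B₃ c.A₀ c.A₁ * p0Profile c.A₀ c.p₀ (D.flow.g (j + 1)) ^ 2 * (X.dC p i + 1) := by
    have := minConst_nonneg c.B₃ c.A₀ c.A₁
    positivity
  have h := exp_live_le hE h0 (hμF p i hi)
  have e1 : c.γ₀ * minConst c.B₃ (μF p i * c.A₀) (μF p i * c.A₁) * p0Profile c.A₀ c.p₀ (D.flow.g (j + 1)) ^ 2 *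
      (X.dC p i + 1) = μF p i ^ 2 * (c.γ₀ * minConst c.B₃ c.A₀ c.A₁ * p0Profile c.A₀ c.p₀ (D.flow.g (j + 1)) ^ 2 *
      (X.dC p i + 1)) := by
    rw [minConst_live]; ring
  show Real.exp _ ≤ Real.exp (-(lam₀ ^ 2 * c.γ₀ * minConst c.B₃ c.A₀ c.A₁ *
    p0Profile c.A₀ c.p₀ (D.flow.g (j + 1)) ^ 2 * (X.dC p i + 1)))
  rw [e1]
  refine h.trans (le_of_eq ?_)
  congr 1
  ring

/-- at `λ₀ = 1` the one-letter live `c` is print's `c` [folklore] -/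
theorem oneLetter_one (c : B16StepFactorsPrinted.Consts) : { c with γ₀ := (1 : ℝ) ^ 2 * c.γ₀ } = c := by
  cases c; simp

end OneLetter

end

end Summit.QuantumFields.BalabanUV.T4Continuum.Spine.NE7c.LiveFactorRoundedRenewal
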